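import Summits.AtomisticToContinuum.Crystallization.Theorems.ExcessDecayLiouvillePhononStabilityCertBlochDefs
import Mathlib.Analysis.Fourier.FiniteAbelian.PontryaginDuality

/-!
# Near-certificate layer B1: the Bloch reduction (finite-torus Plancherel)

Support file for crux `PhononStability` (stmt-AtomisticToContinuum-9333), line `contragredient-window-collapse`:
proof of the registered stub `stub_blochReduction : BlochReduction`.

The pair form `pairSum L w = Σ_{(c,M) ∈ L} Σ_k bil M (Δ_c w̃ k) (Δ_c w̃ k)` (`w̃ = cov w` the covariant coordinates,
`Δ_{(m,m',n)} u k = u (m', k + n) − u (m, k)`) of a finitely supported field `w` is unchanged when `w̃` is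
periodised on the discrete torus `G = (ℤ/(2S+1))³`, `S = R + N` (`R` a support radius of `w`, `N` a bound on the
ranges `|nᵢ|` of the classes of `L`): no bond wraps around.  On the finite abelian group `G` the complex characters
`ψ` satisfy the orthogonality relation `Σ_ψ ψ a = |G| · [a = 0]` (`AddChar.sum_apply_eq_ite`), whence the Parseval
identity `|G| · pairSum L w = Σ_ψ symbolForm L z_ψ ŵ_ψ` with torus phases `z_ψ i = ψ eᵢ` and Fourier amplitudes
`ŵ_ψ m = Σ_g conj (ψ g) · w̃ (m, g)`; every summand on the right is `≥ 0` by `SymbolPSD L`. [folklore]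
-/

noncomputable section

open scoped BigOperators ComplexConjugate
open Set Function
open Summit.AtomisticToContinuum.Crystallization.Theorems.PhononStabilityNegative

namespace Summit.AtomisticToContinuum.Crystallization.Theorems.PhononStabilityCWC.Cert


/-! ## Parseval on a finite abelian group for the sesquilinear form `cbil` -/

section Parseval
variable {G : Type*} [AddCommGroup G] [Fintype G]

/-- Scalar finite Fourier coefficient `â ψ = Σ_g conj (ψ g) · a g`. [folklore] -/
def shat (a : G → ℂ) (ψ : AddChar G ℂ) : ℂ := ∑ g, conj (ψ g) * a g

/-- Vector finite Fourier coefficient of a `ℂ³`-valued function (componentwise `shat`). [folklore] -/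
def fhat (x : G → Fin 3 → ℂ) (ψ : AddChar G ℂ) : Fin 3 → ℂ := fun i => shat (fun g => x g i) ψ

/-- Scalar Parseval identity on a finite abelian group: `Σ_ψ conj (â ψ) · b̂ ψ = |G| · Σ_g conj (a g) · b g`,
from the orthogonality relation `AddChar.sum_apply_eq_ite`. [folklore] -/
theorem parseval_shat (a b : G → ℂ) :
    ∑ ψ : AddChar G ℂ, conj (shat a ψ) * shat b ψ = (Fintype.card G : ℂ) * ∑ g, conj (a g) * b g := by
  classical
  have h1 : ∀ ψ : AddChar G ℂ, conj (shat a ψ) * shat b ψ = ∑ g, ∑ h, ψ (g - h) * (conj (a g) * b h) := by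
    intro ψ
    simp only [shat]
    rw [map_sum, Finset.sum_mul_sum]
    refine Finset.sum_congr rfl fun g _ => Finset.sum_congr rfl fun h _ => ?_
    rw [map_mul, starRingEnd_self_apply, sub_eq_add_neg, AddChar.map_add_eq_mul, AddChar.map_neg_eq_conj]
    ring
  simp only [h1]
  rw [Finset.sum_comm, Finset.mul_sum]
  refine Finset.sum_congr rfl fun g _ => ?_
  rw [Finset.sum_comm]
  have h2 : ∀ h : G, ∑ ψ : AddChar G ℂ, ψ (g - h) * (conj (a g) * b h) =
      if g = h then (Fintype.card G : ℂ) * (conj (a g) * b h) else 0 := by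
    intro h
    rw [← Finset.sum_mul, AddChar.sum_apply_eq_ite, sub_eq_zero, ite_mul, zero_mul]
  simp only [h2]
  rw [Finset.sum_ite_eq, if_pos (Finset.mem_univ g)]

/-- `cbil`-Parseval: `Σ_ψ cbil M (x̂ ψ) (ŷ ψ) = |G| · Σ_g cbil M (x g) (y g)`. [folklore] -/
theorem parseval_cbil (M : Mat) (x y : G → Fin 3 → ℂ) :
    ∑ ψ : AddChar G ℂ, cbil M (fhat x ψ) (fhat y ψ) = (Fintype.card G : ℂ) * ∑ g, cbil M (x g) (y g) := by
  calc ∑ ψ : AddChar G ℂ, cbil M (fhat x ψ) (fhat y ψ)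
      = ∑ i, ∑ j, (M i j : ℂ) * ∑ ψ : AddChar G ℂ, conj (shat (fun g => x g i) ψ) * shat (fun g => y g j) ψ := by
        simp only [cbil, fhat, mul_assoc, Finset.mul_sum]
        rw [Finset.sum_comm]
        exact Finset.sum_congr rfl fun i _ => Finset.sum_comm
    _ = ∑ i, ∑ j, (M i j : ℂ) * ((Fintype.card G : ℂ) * ∑ g, conj (x g i) * y g j) := by
        simp only [parseval_shat]
    _ = (Fintype.card G : ℂ) * ∑ g, cbil M (x g) (y g) := by
        simp only [cbil, mul_assoc, Finset.mul_sum]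
        symm
        rw [Finset.sum_comm]
        refine Finset.sum_congr rfl fun i _ => ?_
        rw [Finset.sum_comm]
        refine Finset.sum_congr rfl fun j _ => Finset.sum_congr rfl fun g _ => ?_
        ring

/-- Shift rule: the Fourier coefficient of `g ↦ x (g + t)` is `ψ t · x̂ ψ`. [folklore] -/
theorem fhat_shift (x : G → Fin 3 → ℂ) (t : G) (ψ : AddChar G ℂ) (i : Fin 3) :
    fhat (fun g => x (g + t)) ψ i = ψ t * fhat x ψ i := by
  simp only [fhat, shat, Finset.mul_sum]
  rw [← Equiv.sum_comp (Equiv.addRight t) (fun g => ψ t * (conj (ψ g) * x g i))]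
  refine Finset.sum_congr rfl fun g _ => ?_
  have h1 : conj (ψ t) * ψ t = 1 := by
    rw [← AddChar.map_neg_eq_conj, ← AddChar.map_add_eq_mul, neg_add_cancel, AddChar.map_zero_eq_one]
  simp only [Equiv.coe_addRight, AddChar.map_add_eq_mul, map_mul]
  linear_combination -(conj (ψ g) * x (g + t) i) * h1

/-- The Fourier coefficient is additive: `(x − y)^ = x̂ − ŷ`. [folklore] -/
theorem fhat_sub (x y : G → Fin 3 → ℂ) (ψ : AddChar G ℂ) (i : Fin 3) :
    fhat (fun g => x g - y g) ψ i = fhat x ψ i - fhat y ψ i := by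
  simp only [fhat, shat, Pi.sub_apply, mul_sub, Finset.sum_sub_distrib]

end Parseval

/-! ## The discrete torus `(ℤ/(2S+1))³` and the box `[-S, S]³` -/

section Torus
variable (S : ℕ)

/-- The discrete torus `(ℤ/(2S+1))³`. [folklore] -/
abbrev TG : Type := Fin 3 → ZMod (2 * S + 1)

/-- Reduction of a lattice vector modulo `2S + 1`. [folklore] -/
def toG (k : Fin 3 → ℤ) : TG S := fun i => (k i : ZMod (2 * S + 1))

/-- The balanced representative of a torus point in the box `[-S, S]³`. [folklore] -/
def ofG (g : TG S) : Fin 3 → ℤ := fun i => (g i).valMinAbs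

/-- The box `[-S, S]³`. [folklore] -/
def tbox : Finset (Fin 3 → ℤ) := Fintype.piFinset fun _ => Finset.Icc (-(S : ℤ)) S

/-- Membership in the box. [folklore] -/
theorem mem_tbox {k : Fin 3 → ℤ} : k ∈ tbox S ↔ ∀ i, |k i| ≤ S := by
  simp [tbox, Fintype.mem_piFinset, abs_le]

/-- Reduction is additive. [folklore] -/
theorem toG_add (k n : Fin 3 → ℤ) : toG S (k + n) = toG S k + toG S n := by
  funext i; simp [toG]

/-- Reducing the balanced representative gives the point back. [folklore] -/
theorem toG_ofG (g : TG S) : toG S (ofG S g) = g := by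
  funext i; simp [toG, ofG, ZMod.coe_valMinAbs]

/-- The balanced representative lies in the box. [folklore] -/
theorem abs_ofG_le (g : TG S) (i : Fin 3) : |ofG S g i| ≤ S := by
  have h := ZMod.natAbs_valMinAbs_le (g i)
  have h2 : (2 * S + 1) / 2 = S := by omega
  rw [h2] at h
  simp only [ofG]
  rw [Int.abs_eq_natAbs]
  exact_mod_cast h

/-- A box vector is the balanced representative of its reduction. [folklore] -/
theorem ofG_toG {k : Fin 3 → ℤ} (hk : ∀ i, |k i| ≤ S) : ofG S (toG S k) = k := by
  funext i
  simp only [ofG, toG]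
  rw [ZMod.valMinAbs_spec]
  obtain ⟨h1, h2⟩ := abs_le.mp (hk i)
  refine ⟨rfl, ?_, ?_⟩
  · push_cast; linarith
  · push_cast; linarith

/-- Sums over the torus are sums over the box. [folklore] -/
theorem sum_TG_eq_sum_tbox {β : Type*} [AddCommMonoid β] (h : TG S → β) :
    ∑ g, h g = ∑ k ∈ tbox S, h (toG S k) := by
  symm
  exact Finset.sum_nbij' (toG S) (ofG S) (fun _ _ => Finset.mem_univ _)
    (fun g _ => (mem_tbox S).2 (abs_ofG_le S g)) (fun k hk => ofG_toG S ((mem_tbox S).1 hk))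
    (fun g _ => toG_ofG S g) (fun _ _ => rfl)

/-- **No wrap-around.** A label function supported in radius `R` takes the same value at `j` and at the balanced
representative of `j mod (2S+1)` whenever `|jᵢ| ≤ S + N` and `R + N ≤ S` (both values vanish unless they agree).
[folklore] -/
theorem wrap {β : Type*} [Zero β] {u : Label → β} {R N : ℕ} (hu : ∀ ℓ, u ℓ ≠ 0 → ∀ i, |ℓ.2 i| ≤ R)
    (hS : R + N ≤ S) (m : Fin 2) (j : Fin 3 → ℤ) (hj : ∀ i, |j i| ≤ (S : ℤ) + N) :
    u (m, ofG S (toG S j)) = u (m, j) := by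
  by_cases h : ofG S (toG S j) = j
  · rw [h]
  have hj0 : u (m, j) = 0 := by
    by_contra hne
    refine h (ofG_toG S fun i => (hu (m, j) hne i).trans ?_)
    exact_mod_cast le_trans (Nat.le_add_right R N) hS
  have hv0 : u (m, ofG S (toG S j)) = 0 := by
    by_contra hne
    have hv : ∀ i, |ofG S (toG S j) i| ≤ R := hu _ hne
    apply h
    funext i
    have hdvd : ((2 * S + 1 : ℕ) : ℤ) ∣ j i - ofG S (toG S j) i := by
      rw [← ZMod.intCast_eq_intCast_iff_dvd_sub]
      simp [ofG, toG, ZMod.coe_valMinAbs]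
    have hlt : |j i - ofG S (toG S j) i| < ((2 * S + 1 : ℕ) : ℤ) := by
      have e1 := abs_le.mp (hv i)
      have e2 := abs_le.mp (hj i)
      rw [abs_lt]
      push_cast
      constructor <;> omega
    have := Int.eq_zero_of_abs_lt_dvd hdvd hlt
    omega
  rw [hj0, hv0]

/-! ## Characters of the discrete torus as torus phases -/

/-- Torus phases of a character: `z_ψ i = ψ eᵢ`. [folklore] -/
def zOfChar (ψ : AddChar (TG S) ℂ) : Fin 3 → ℂ := fun i => ψ (Pi.single i 1)

/-- Character values lie on the unit circle. [folklore] -/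
theorem zOfChar_mem (ψ : AddChar (TG S) ℂ) : zOfChar S ψ ∈ unitTorus := fun _ => AddChar.norm_apply ψ _

/-- A character at a reduced lattice vector is the phase monomial of its torus phases. [folklore] -/
theorem psi_toG (ψ : AddChar (TG S) ℂ) (n : Fin 3 → ℤ) : ψ (toG S n) = phase (zOfChar S ψ) n := by
  have h : toG S n = n 0 • (Pi.single 0 1 : TG S) + n 1 • (Pi.single 1 1 : TG S) + n 2 • (Pi.single 2 1 : TG S) := by
    funext j
    fin_cases j <;> simp [toG]
  rw [h, AddChar.map_add_eq_mul, AddChar.map_add_eq_mul, AddChar.map_zsmul_eq_zpow, AddChar.map_zsmul_eq_zpow,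
    AddChar.map_zsmul_eq_zpow]
  simp [phase, zOfChar, Fin.prod_univ_three]

/-! ## Periodisation of a finitely supported field -/

variable (w : Label → EuclideanSpace ℝ (Fin 3))

/-- Complexification of a real covector. [folklore] -/
def cplx (x : Fin 3 → ℝ) : Fin 3 → ℂ := fun i => (x i : ℂ)

/-- `cbil` on complexified covectors is `bil`. [folklore] -/
theorem cbil_cplx (M : Mat) (x y : Fin 3 → ℝ) : cbil M (cplx x) (cplx y) = ((bil M x y : ℝ) : ℂ) := by
  simp only [cbil, bil, cplx, Complex.conj_ofReal]
  push_cast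
  rfl

/-- The periodised covariant field `g ↦ w̃ (m, ofG g)` on the discrete torus. [folklore] -/
def perF (m : Fin 2) (g : TG S) : Fin 3 → ℂ := cplx (cov w (m, ofG S g))

/-- The periodised bond difference of a class. [folklore] -/
def perD (c : BondClass) : TG S → Fin 3 → ℂ := fun g => perF S w c.2.1 (g + toG S c.2.2) - perF S w c.1 g

/-- Fourier amplitudes of the periodised field: `ŵ_ψ m = (perF m)^ ψ`. [folklore] -/
def aOf (ψ : AddChar (TG S) ℂ) : Fin 2 → Fin 3 → ℂ := fun m => fhat (perF S w m) ψ

/-- The Bloch difference of the Fourier amplitudes is the Fourier coefficient of the periodised bond difference.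
[folklore] -/
theorem blochDiff_eq (c : BondClass) (ψ : AddChar (TG S) ℂ) :
    blochDiff c (zOfChar S ψ) (aOf S w ψ) = fhat (perD S w c) ψ := by
  funext i
  unfold perD
  simp only [blochDiff, aOf]
  rw [fhat_sub, fhat_shift, psi_toG]

/-- From `|a + b| ≤ R` and `|b| ≤ N`: `|a| ≤ R + N`. -/
private theorem abs_le_of_abs_add_le {a b : ℤ} {R N : ℕ} (h1 : |a + b| ≤ R) (h2 : |b| ≤ N) :
    |a| ≤ (R : ℤ) + N := by
  rw [abs_le] at *; omega

/-- **Periodisation is exact.** For `R + N ≤ S` the torus pair form of the periodised field equals the lattice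
pair form `pairEval c M w`. [folklore] -/
theorem sum_perD_eq {R N : ℕ} (hR : ∀ ℓ, w ℓ ≠ 0 → ∀ i, |ℓ.2 i| ≤ R) (hS : R + N ≤ S) (c : BondClass)
    (hc : ∀ i, |c.2.2 i| ≤ N) (M : Mat) :
    ∑ g, cbil M (perD S w c g) (perD S w c g) = ((pairEval c M w : ℝ) : ℂ) := by
  obtain ⟨m, m', n⟩ := c
  have hcov : ∀ ℓ, cov w ℓ ≠ 0 → ∀ i, |ℓ.2 i| ≤ R := fun ℓ hℓ => hR ℓ fun h0 => hℓ (cov_eq_zero_of h0)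
  have hd : ∀ k, covDiff (m, m', n) w k = cov w (m', k + n) - cov w (m, k) := fun k => covOf_sub _ _
  have hRS : (R : ℤ) ≤ S := by exact_mod_cast le_trans (Nat.le_add_right R N) hS
  have h1 : pairEval (m, m', n) M w =
      ∑ k ∈ tbox S, bil M (covDiff (m, m', n) w k) (covDiff (m, m', n) w k) := by
    unfold pairEval
    refine tsum_eq_sum fun k hk => ?_
    rw [mem_tbox, not_forall] at hk
    obtain ⟨i, hi⟩ := hk
    rw [not_le] at hi
    have hk0 : cov w (m, k) = 0 := by
      by_contra h
      linarith [hcov (m, k) h i]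
    have hk1 : cov w (m', k + n) = 0 := by
      by_contra h
      have := abs_le_of_abs_add_le (hcov (m', k + n) h i) (hc i)
      have h' : (R : ℤ) + N ≤ S := by exact_mod_cast hS
      linarith
    rw [hd, hk0, hk1, sub_zero]
    simp [bil]
  rw [h1, sum_TG_eq_sum_tbox, Complex.ofReal_sum]
  refine Finset.sum_congr rfl fun k hk => ?_
  rw [mem_tbox] at hk
  have hkn : ∀ i, |(k + n) i| ≤ (S : ℤ) + N := by
    intro i
    have e1 := abs_le.mp (hk i)
    have e2 := abs_le.mp (hc i)
    rw [Pi.add_apply, abs_le]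
    constructor <;> linarith
  have hX : perD S w (m, m', n) (toG S k) = cplx (covDiff (m, m', n) w k) := by
    funext i
    simp only [perD, perF, cplx, Pi.sub_apply, hd]
    rw [← toG_add, ofG_toG S hk, wrap S hcov hS m' (k + n) hkn]
    push_cast
    rfl
  rw [hX, cbil_cplx]

/-- **Parseval for one entry.** `Σ_ψ Re cbil M (Δ_c(z_ψ) ŵ_ψ) (Δ_c(z_ψ) ŵ_ψ) = |G| · pairEval c M w`. [folklore] -/
theorem sum_symbol_entry {R N : ℕ} (hR : ∀ ℓ, w ℓ ≠ 0 → ∀ i, |ℓ.2 i| ≤ R) (hS : R + N ≤ S)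
    (e : BondClass × Mat) (he : ∀ i, |e.1.2.2 i| ≤ N) :
    ∑ ψ : AddChar (TG S) ℂ,
        (cbil e.2 (blochDiff e.1 (zOfChar S ψ) (aOf S w ψ)) (blochDiff e.1 (zOfChar S ψ) (aOf S w ψ))).re =
      (Fintype.card (TG S) : ℝ) * pairEval e.1 e.2 w := by
  rw [← Complex.re_sum]
  simp only [blochDiff_eq]
  rw [parseval_cbil, sum_perD_eq S w hR hS e.1 he e.2, ← Complex.ofReal_natCast, ← Complex.ofReal_mul,
    Complex.ofReal_re]

/-- **Parseval for a list.** `Σ_ψ symbolForm L z_ψ ŵ_ψ = |G| · pairSum L w`. [folklore] -/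
theorem sum_symbolForm_eq {R N : ℕ} (hR : ∀ ℓ, w ℓ ≠ 0 → ∀ i, |ℓ.2 i| ≤ R) (hS : R + N ≤ S) :
    ∀ L : List (BondClass × Mat), (∀ e ∈ L, ∀ i, |e.1.2.2 i| ≤ N) →
      ∑ ψ : AddChar (TG S) ℂ, symbolForm L (zOfChar S ψ) (aOf S w ψ) = (Fintype.card (TG S) : ℝ) * pairSum L w
  | [], _ => by simp [symbolForm_nil, pairSum_nil]
  | e :: L, hL => by
      have h1 : ∀ (z : Fin 3 → ℂ) (a : Fin 2 → Fin 3 → ℂ), symbolForm (e :: L) z a =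
          (cbil e.2 (blochDiff e.1 z a) (blochDiff e.1 z a)).re + symbolForm L z a := by
        intro z a; simp [symbolForm]
      have h2 : pairSum (e :: L) w = pairEval e.1 e.2 w + pairSum L w := by simp [pairSum]
      simp only [h1, h2, Finset.sum_add_distrib, mul_add]
      rw [sum_symbol_entry S w hR hS e (hL e List.mem_cons_self),
        sum_symbolForm_eq hR hS L fun e' he' => hL e' (List.mem_cons_of_mem _ he')]

end Torus

/-! ## The reduction -/

/-- Nonnegativity of the pair form from `SymbolPSD`, given a support radius `R` of the field and a range bound `N`
of the list. [folklore] -/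
theorem pairSum_nonneg_of_bounds (L : List (BondClass × Mat)) (hL : SymbolPSD L) {R N : ℕ}
    (w : Label → EuclideanSpace ℝ (Fin 3)) (hR : ∀ ℓ, w ℓ ≠ 0 → ∀ i, |ℓ.2 i| ≤ R)
    (hN : ∀ e ∈ L, ∀ i, |e.1.2.2 i| ≤ N) : 0 ≤ pairSum L w := by
  have key := sum_symbolForm_eq (R + N) w hR le_rfl L hN
  have hpos : (0 : ℝ) < Fintype.card (TG (R + N)) := Nat.cast_pos.mpr Fintype.card_pos
  have hnn : 0 ≤ ∑ ψ : AddChar (TG (R + N)) ℂ, symbolForm L (zOfChar (R + N) ψ) (aOf (R + N) w ψ) :=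
    Finset.sum_nonneg fun ψ _ => hL _ (zOfChar_mem (R + N) ψ) _
  rw [key] at hnn
  exact (mul_nonneg_iff_of_pos_left hpos).mp hnn

/-- **Stub B1 — BLOCH REDUCTION.** A pair-table list whose Bloch symbol is positive semidefinite on the phase
torus has a nonnegative pair form on finitely supported fields (finite-torus Plancherel). [folklore] -/
theorem stub_blochReduction : BlochReduction := by
  intro L hL w hw
  classical
  refine pairSum_nonneg_of_bounds L hL w
    (R := hw.toFinset.sup fun ℓ => Finset.univ.sup fun i => (ℓ.2 i).natAbs)
    (N := (L.map fun e => Finset.univ.sup fun i => (e.1.2.2 i).natAbs).sum) ?_ ?_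
  · intro ℓ hℓ i
    have hmem : ℓ ∈ hw.toFinset := hw.mem_toFinset.mpr hℓ
    have h1 : (ℓ.2 i).natAbs ≤ Finset.univ.sup fun i => (ℓ.2 i).natAbs :=
      Finset.le_sup (f := fun i => (ℓ.2 i).natAbs) (Finset.mem_univ i)
    have h2 : (Finset.univ.sup fun i => (ℓ.2 i).natAbs) ≤
        hw.toFinset.sup fun ℓ => Finset.univ.sup fun i => (ℓ.2 i).natAbs :=
      Finset.le_sup (f := fun ℓ : Label => Finset.univ.sup fun i => (ℓ.2 i).natAbs) hmem
    rw [Int.abs_eq_natAbs]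
    exact_mod_cast h1.trans h2
  · intro e he i
    have h1 : (e.1.2.2 i).natAbs ≤ Finset.univ.sup fun i => (e.1.2.2 i).natAbs :=
      Finset.le_sup (f := fun i => (e.1.2.2 i).natAbs) (Finset.mem_univ i)
    have h2 : (Finset.univ.sup fun i => (e.1.2.2 i).natAbs) ≤
        (L.map fun e => Finset.univ.sup fun i => (e.1.2.2 i).natAbs).sum :=
      List.le_sum_of_mem (List.mem_map.mpr ⟨e, he, rfl⟩)
    rw [Int.abs_eq_natAbs]
    exact_mod_cast h1.trans h2

end Summit.AtomisticToContinuum.Crystallization.Theorems.PhononStabilityCWC.Cert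

end
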